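import Literature.NumberTheory.EllipticCurves.BurungaleCastellaSkinner2025.ProductDivisibilitiesIntegralityProofs
import Literature.NumberTheory.IwasawaTheory.IwasawaAlgebraTwoVarRegularProofs
import Mathlib.RingTheory.UniqueFactorizationDomain.Multiplicity
import HarnessLib

/-!
# K1′ `TwistPairGreenbergProductDivisibilitySplit` (stmt-BirchSwinnertonDyer-20502), line `acanchor`:
# the RATIONAL anchor — both research stubs weakened to their `ℚ_p`-forms (helper `--supports` 20502; lead sbc-p1 g5)

The landed composition of line `acanchor` (`…SplitAcanchorGlue`, p534867/p536497: K1′ ⇐ ES ∧ ACμ ∧ ACdiv) asks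
for the two-variable Euler-system inclusion ES `(G) ⊆ ch·𝒪_{ℂ_p}⟦T₁,T₂⟧` and the anticyclotomic anchor ACdiv
`ch|_{T₁=0} ⊆ (G⁻)` INTEGRALLY, because its rigidity lemma (`le_span_of_anchor`) is local-ring algebra. The
literature proves such inclusions first RATIONALLY, i.e. up to a power of `p` (e.g. the tree's
`YanZhu2026.thm57_…` rational clauses, Büyükboduk–Lei 2016 Thm. 1.3 with its fudge factor, CÇSS 2018 "up to
exceptional primes"). This file proves that the rational forms suffice, at no extra cost in named facts:

* §1 **`p`-saturation of `Λ_K`-rational divisors in `𝒪_{ℂ_p}⟦T₂⟧⟦T₁⟧`**: if `c ∈ Λ_K = ℤ_p⟦T₂⟧⟦T₁⟧` is not divisible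
  by `p`, its image along any structure map `J : ℤ_p → 𝒪_{ℂ_p}` divides `p·x` only if it divides `x`
  (`dvd_of_toUnr₂_dvd_natCast_mul`; proof: modulo `p` the coefficients of `c` are `0` or units, and such a
  series is a non-zero-divisor in `(𝒪_{ℂ_p}/p)⟦T₂⟧⟦T₁⟧` by a lowest-corner-coefficient argument — `𝒪_{ℂ_p}/p` is not
  reduced, so the generic `order_mul` is unavailable).
* §2 **the rational rigidity theorem** `map_le_span_of_rational_anchor`: for a principal ideal `I ⊆ Λ_K`, a
  structure map `J` and `G ∈ 𝒪_{ℂ_p}⟦T₂⟧⟦T₁⟧` with `μ(G⁻) = 0` (`HasUnitContent (minus G)`):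
  ES-rat `∃ a, p^a·G ∈ I·𝒪⟦T₁,T₂⟧` and ACdiv-rat `∃ b, p^b·(I·𝒪⟦T₁,T₂⟧)|_{T₁=0} ⊆ (G⁻)` already give the INTEGRAL
  Eisenstein inclusion `I·𝒪⟦T₁,T₂⟧ ⊆ (G)`. Proof: write the generator `c₀ = p^μ c₁` with `p ∤ c₁` in the UFD `Λ_K`;
  from `c ∣ p^a G` get `μ ≤ a` (else `p ∣ G⁻`, contradicting `μ(G⁻) = 0`) and, by §1, `c₁ ∣ G`, `G = c₁ g`; then
  `G⁻ = c₁⁻ g⁻` forces `μ(g⁻) = 0`, ACdiv-rat on the line gives `g⁻ ∣ p^{b+μ}`, and the tree's cancellation theorem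
  (`dvd_of_dvd_map_C_mul_of_hasUnitContent_minus`, Weierstrass division) makes `g⁻`, hence `g`, a unit.
* §3 the two registered stubs imply their rational forms trivially (`a = b = 0`), so the reshaped line is a pure
  WEAKENING of `acanchor` v2; the composition K1′ ⇐ ES-rat ∧ ACunit ∧ ACdiv-rat (texts = the reshaped stubs) and
  ACunit ⇐ the guarded BCS 2025 Prop. 4.2.2 by name are in the companion file `…SplitRationalAnchorGlue`.

No new definitions; nothing here asserts ES, ACdiv or the conjectures behind them. This file is ROUTE-INDEPENDENT (no `Theses`
import): pure algebra of the receptacle `𝒪_{ℂ_p}⟦T₂⟧⟦T₁⟧ ⊇ Λ_K^ur`.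
-/

-- D-0017: single-problem summit, the namespace repeats the problem name by design.
set_option linter.dupNamespace false
set_option autoImplicit false

noncomputable section

open scoped Classical

namespace Summit.BirchSwinnertonDyer.BirchSwinnertonDyer.Theorems.SignedBaseChangeK1RationalAnchor

open Literature.NumberTheory.EllipticCurves Literature.NumberTheory.EllipticCurves.GreenbergVatsal2000
  Literature.NumberTheory.EllipticCurves.UnrSeries₂ Literature.NumberTheory.EllipticCurves.IwasawaAlgebra₂

variable {p : ℕ} [Fact p.Prime]

/-! ## §1 `p`-saturation of `Λ_K`-rational divisors -/

/-- The coefficient of a product of power series at the sum of the orders is the product of the lowest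
coefficients (any semiring; the `NoZeroDivisors`-free half of Mathlib's `PowerSeries.order_mul`). [folklore] -/
theorem coeff_mul_order_toNat_add {R : Type*} [Semiring R] (φ ψ : PowerSeries R) :
    PowerSeries.coeff (φ.order.toNat + ψ.order.toNat) (φ * ψ) =
      PowerSeries.coeff φ.order.toNat φ * PowerSeries.coeff ψ.order.toNat ψ := by
  rw [PowerSeries.coeff_mul, Finset.sum_eq_single_of_mem (φ.order.toNat, ψ.order.toNat) (by simp)]
  intro ij hij hne
  rcases trichotomy_of_add_eq_add (Finset.HasAntidiagonal.mem_antidiagonal.mp hij) with h' | h' | h'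
  · exact (hne (by simp [Prod.ext_iff, h'.1, h'.2])).elim
  · rw [PowerSeries.coeff_of_lt_order_toNat ij.1 h', zero_mul]
  · rw [PowerSeries.coeff_of_lt_order_toNat ij.2 h', mul_zero]

/-- **A nonzero two-variable series all of whose coefficients are `0` or units is a non-zero-divisor**, over ANY
commutative ring (here `𝒪_{ℂ_p}/p`, which is not reduced): compare lowest-corner coefficients. [folklore] -/
theorem eq_zero_of_crisp_mul_eq_zero {A : Type*} [CommRing A] {F z : PowerSeries (PowerSeries A)}
    (hF : F ≠ 0)
    (hcrisp : ∀ i j : ℕ, PowerSeries.coeff j (PowerSeries.coeff i F) = 0 ∨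
      IsUnit (PowerSeries.coeff j (PowerSeries.coeff i F)))
    (h : F * z = 0) : z = 0 := by
  by_contra hz
  have h1 := coeff_mul_order_toNat_add F z
  rw [h, map_zero] at h1
  set Fi := PowerSeries.coeff F.order.toNat F with hFi_def
  set zm := PowerSeries.coeff z.order.toNat z with hzm_def
  have hFi : Fi ≠ 0 := PowerSeries.coeff_order hF
  have hzm : zm ≠ 0 := PowerSeries.coeff_order hz
  have h2 := coeff_mul_order_toNat_add Fi zm
  rw [← h1, map_zero] at h2
  have hα : IsUnit (PowerSeries.coeff Fi.order.toNat Fi) :=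
    (hcrisp F.order.toNat Fi.order.toNat).resolve_left (PowerSeries.coeff_order hFi)
  exact PowerSeries.coeff_order hzm (hα.mul_right_eq_zero.mp h2.symm)

/-- In `Λ_K = ℤ_p⟦T₂⟧⟦T₁⟧`: if every coefficient of `c` is divisible by `p`, then `p ∣ c`. [folklore] -/
theorem natCast_dvd_of_forall_dvd_coeff {c : IwasawaAlgebra₂ p}
    (h : ∀ i j : ℕ, (p : ℤ_[p]) ∣ PowerSeries.coeff j (PowerSeries.coeff i c)) :
    ((p : ℕ) : IwasawaAlgebra₂ p) ∣ c := by
  choose b hb using h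
  refine ⟨PowerSeries.mk fun i ↦ PowerSeries.mk fun j ↦ b i j, ?_⟩
  ext i j : 2
  rw [show ((p : ℕ) : IwasawaAlgebra₂ p) = PowerSeries.C (PowerSeries.C ((p : ℕ) : ℤ_[p])) by
    rw [map_natCast, map_natCast], PowerSeries.coeff_C_mul, PowerSeries.coeff_C_mul,
    PowerSeries.coeff_mk, PowerSeries.coeff_mk]
  exact hb i j

/-- `p` is not a unit of `𝒪_{ℂ_p}` (`‖p‖ = p⁻¹ < 1`). [folklore] -/
theorem not_isUnit_natCast_padicComplexInt : ¬ IsUnit ((p : ℕ) : PadicComplexInt p) := by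
  have hp : p.Prime := Fact.out
  rw [isUnit_padicComplexInt_iff]
  have h1 : ‖(((p : ℕ) : PadicComplexInt p) : ℂ_[p])‖ = (p : ℝ)⁻¹ := by
    rw [show (((p : ℕ) : PadicComplexInt p) : ℂ_[p]) = ((p : ℚ_[p]) : ℂ_[p]) by simp,
      PadicComplex.norm_extends', Padic.norm_p]
  rw [h1]
  exact ne_of_lt (inv_lt_one_of_one_lt₀ (by exact_mod_cast hp.one_lt))

/-- `p ≠ 0` in `𝒪_{ℂ_p}⟦T₂⟧⟦T₁⟧`. [folklore] -/
theorem natCast_ne_zero₂ : ((p : ℕ) : PowerSeries (PowerSeries (PadicComplexInt p))) ≠ 0 := by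
  rw [show ((p : ℕ) : PowerSeries (PowerSeries (PadicComplexInt p))) =
      PowerSeries.C (PowerSeries.C ((p : ℕ) : PadicComplexInt p)) by rw [map_natCast, map_natCast]]
  intro h
  have h1 := congrArg (fun F ↦ PowerSeries.constantCoeff (PowerSeries.constantCoeff F)) h
  simp only [PowerSeries.constantCoeff_C, map_zero] at h1
  exact natCast_prime_padicComplexInt_ne_zero h1

/-- **`p`-saturation.** If `c ∈ Λ_K` is not divisible by `p`, then along any structure map `J : ℤ_p → 𝒪_{ℂ_p}` its
image `c' ∈ 𝒪_{ℂ_p}⟦T₂⟧⟦T₁⟧` satisfies `c' ∣ p·x ⇒ c' ∣ x`. Modulo `p` the coefficients of `c'` are `0` or units and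
not all `0`, so `c'` is a non-zero-divisor mod `p` (`eq_zero_of_crisp_mul_eq_zero`). [folklore] -/
theorem dvd_of_toUnr₂_dvd_natCast_mul {c : IwasawaAlgebra₂ p} (hc : ¬ ((p : ℕ) : IwasawaAlgebra₂ p) ∣ c)
    (J : ℤ_[p] →+* PadicComplexInt p) {x : PowerSeries (PowerSeries (PadicComplexInt p))}
    (h : toUnr₂ p J c ∣ ((p : ℕ) : PowerSeries (PowerSeries (PadicComplexInt p))) * x) :
    toUnr₂ p J c ∣ x := by
  obtain ⟨z, hz⟩ := h
  -- reduction modulo `p`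
  let I : Ideal (PadicComplexInt p) := Ideal.span {((p : ℕ) : PadicComplexInt p)}
  let q : PadicComplexInt p →+* PadicComplexInt p ⧸ I := Ideal.Quotient.mk I
  let Φ : PowerSeries (PowerSeries (PadicComplexInt p)) →+* PowerSeries (PowerSeries (PadicComplexInt p ⧸ I)) :=
    PowerSeries.map (PowerSeries.map q)
  have hqp : q ((p : ℕ) : PadicComplexInt p) = 0 :=
    Ideal.Quotient.eq_zero_iff_mem.mpr (Ideal.mem_span_singleton_self _)
  have hΦp : Φ ((p : ℕ) : PowerSeries (PowerSeries (PadicComplexInt p))) = 0 := by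
    rw [map_natCast, show ((p : ℕ) : PowerSeries (PowerSeries (PadicComplexInt p ⧸ I))) =
      PowerSeries.C (PowerSeries.C (q ((p : ℕ) : PadicComplexInt p))) by
        rw [map_natCast, map_natCast, map_natCast], hqp, map_zero, map_zero]
  have hkey : Φ (toUnr₂ p J c) * Φ z = 0 := by
    rw [← map_mul, ← hz, map_mul, hΦp, zero_mul]
  -- the reduction of `c'` is crisp …
  have hcoeff : ∀ i j : ℕ, PowerSeries.coeff j (PowerSeries.coeff i (Φ (toUnr₂ p J c))) =
      q (J (PowerSeries.coeff j (PowerSeries.coeff i c))) := by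
    intro i j
    simp only [Φ, PowerSeries.coeff_map, coeff_coeff_toUnr₂]
  have hcrisp : ∀ i j : ℕ, PowerSeries.coeff j (PowerSeries.coeff i (Φ (toUnr₂ p J c))) = 0 ∨
      IsUnit (PowerSeries.coeff j (PowerSeries.coeff i (Φ (toUnr₂ p J c)))) := by
    intro i j
    rw [hcoeff]
    by_cases ha : (p : ℤ_[p]) ∣ PowerSeries.coeff j (PowerSeries.coeff i c)
    · left
      obtain ⟨b, hb⟩ := ha
      rw [hb, map_mul, map_natCast, map_mul, map_natCast, ← map_natCast q, hqp, zero_mul]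
    · right
      have hu : IsUnit (PowerSeries.coeff j (PowerSeries.coeff i c)) := by
        rw [PadicInt.isUnit_iff]
        exact le_antisymm (PadicInt.norm_le_one _)
          (not_lt.mp fun hlt ↦ ha ((PadicInt.norm_lt_one_iff_dvd _).mp hlt))
      exact (hu.map J).map q
  -- … and nonzero
  have hI : I ≠ ⊤ := by
    rw [Ne, Ideal.span_singleton_eq_top]
    exact not_isUnit_natCast_padicComplexInt
  haveI : Nontrivial (PadicComplexInt p ⧸ I) := Ideal.Quotient.nontrivial_iff.mpr hI
  have hne : Φ (toUnr₂ p J c) ≠ 0 := by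
    obtain ⟨i, j, hij⟩ : ∃ i j : ℕ, ¬ (p : ℤ_[p]) ∣ PowerSeries.coeff j (PowerSeries.coeff i c) := by
      by_contra hall
      push Not at hall
      exact hc (natCast_dvd_of_forall_dvd_coeff hall)
    have hu : IsUnit (PowerSeries.coeff j (PowerSeries.coeff i c)) := by
      rw [PadicInt.isUnit_iff]
      exact le_antisymm (PadicInt.norm_le_one _)
        (not_lt.mp fun hlt ↦ hij ((PadicInt.norm_lt_one_iff_dvd _).mp hlt))
    intro h0
    have h1 : PowerSeries.coeff j (PowerSeries.coeff i (Φ (toUnr₂ p J c))) = 0 := by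
      rw [h0, map_zero, map_zero]
    rw [hcoeff] at h1
    exact ((hu.map J).map q).ne_zero h1
  -- hence `Φ z = 0`: every coefficient of `z` is divisible by `p`
  have hΦz : Φ z = 0 := eq_zero_of_crisp_mul_eq_zero hne hcrisp hkey
  have hzc : ∀ i j : ℕ, ∃ w : PadicComplexInt p,
      PowerSeries.coeff j (PowerSeries.coeff i z) = ((p : ℕ) : PadicComplexInt p) * w := by
    intro i j
    have h1 : PowerSeries.coeff j (PowerSeries.coeff i (Φ z)) = 0 := by rw [hΦz, map_zero, map_zero]
    simp only [Φ, PowerSeries.coeff_map] at h1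
    obtain ⟨w, hw⟩ := Ideal.mem_span_singleton'.mp (Ideal.Quotient.eq_zero_iff_mem.mp h1)
    exact ⟨w, by rw [← hw, mul_comm]⟩
  choose w hw using hzc
  have hzw : z = ((p : ℕ) : PowerSeries (PowerSeries (PadicComplexInt p))) *
      PowerSeries.mk fun i ↦ PowerSeries.mk fun j ↦ w i j := by
    ext i j : 2
    rw [show ((p : ℕ) : PowerSeries (PowerSeries (PadicComplexInt p))) =
      PowerSeries.C (PowerSeries.C ((p : ℕ) : PadicComplexInt p)) by rw [map_natCast, map_natCast],
      PowerSeries.coeff_C_mul, PowerSeries.coeff_C_mul, PowerSeries.coeff_mk, PowerSeries.coeff_mk]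
    exact hw i j
  refine ⟨PowerSeries.mk fun i ↦ PowerSeries.mk fun j ↦ w i j, mul_left_cancel₀ natCast_ne_zero₂ ?_⟩
  rw [hz, hzw]
  ring

/-- Iterated `p`-saturation: `c' ∣ p^k·x ⇒ c' ∣ x`. [folklore] -/
theorem dvd_of_toUnr₂_dvd_natCast_pow_mul {c : IwasawaAlgebra₂ p} (hc : ¬ ((p : ℕ) : IwasawaAlgebra₂ p) ∣ c)
    (J : ℤ_[p] →+* PadicComplexInt p) (k : ℕ) {x : PowerSeries (PowerSeries (PadicComplexInt p))}
    (h : toUnr₂ p J c ∣ ((p : ℕ) : PowerSeries (PowerSeries (PadicComplexInt p))) ^ k * x) :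
    toUnr₂ p J c ∣ x := by
  induction k with
  | zero => simpa using h
  | succ k ih =>
    refine ih (dvd_of_toUnr₂_dvd_natCast_mul hc J ?_)
    rwa [← mul_assoc, ← pow_succ']

/-! ## §2 The rational rigidity theorem -/

/-- Unit content passes to a factor: over a local coefficient ring, if no coefficient of `y` is a unit then no
coefficient of `x·y` is. [folklore] -/
theorem hasUnitContent_right_of_mul {R : Type*} [CommRing R] [IsLocalRing R] {x y : PowerSeries R}
    (h : HasUnitContent (x * y)) : HasUnitContent y := by
  by_contra hy
  have hy' : ∀ j : ℕ, PowerSeries.coeff j y ∈ IsLocalRing.maximalIdeal R := fun j ↦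
    (IsLocalRing.mem_maximalIdeal _).mpr fun hu ↦ hy ⟨j, hu⟩
  obtain ⟨n, hn⟩ := h
  refine (IsLocalRing.mem_maximalIdeal _).mp ?_ hn
  rw [PowerSeries.coeff_mul]
  exact Ideal.sum_mem _ fun ij _ ↦ Ideal.mul_mem_left _ _ (hy' ij.2)

/-- `p` is not a unit of `Λ_K`. [folklore] -/
theorem not_isUnit_natCast_iwasawaAlgebra₂ : ¬ IsUnit ((p : ℕ) : IwasawaAlgebra₂ p) := by
  intro h
  have h1 := (h.map (PowerSeries.constantCoeff (R := IwasawaAlgebra p))).map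
    (PowerSeries.constantCoeff (R := ℤ_[p]))
  rw [map_natCast, map_natCast, PadicInt.isUnit_iff] at h1
  have hp : p.Prime := Fact.out
  have h2 : ‖((p : ℕ) : ℤ_[p])‖ < 1 := by
    rw [PadicInt.norm_lt_one_iff_dvd]
  exact (ne_of_lt h2) h1

/-- A series in `(p)·𝒪_{ℂ_p}⟦T⟧` times anything has no unit coefficient. [folklore] -/
theorem not_hasUnitContent_natCast_mul (y : PowerSeries (PadicComplexInt p)) :
    ¬ HasUnitContent (((p : ℕ) : PowerSeries (PadicComplexInt p)) * y) := by
  rintro ⟨n, hn⟩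
  rw [show ((p : ℕ) : PowerSeries (PadicComplexInt p)) = PowerSeries.C ((p : ℕ) : PadicComplexInt p) by
    rw [map_natCast], PowerSeries.coeff_C_mul] at hn
  exact not_isUnit_natCast_padicComplexInt (isUnit_of_mul_isUnit_left hn)

/-- **Rational rigidity.** `I ⊆ Λ_K` principal, `J` a structure map, `G ∈ 𝒪_{ℂ_p}⟦T₂⟧⟦T₁⟧` with `μ(G⁻) = 0`. If
`p^a·G ∈ I·𝒪⟦T₁,T₂⟧` for some `a` (rational Euler-system inclusion) and `p^b·(I·𝒪⟦T₁,T₂⟧)|_{T₁=0} ⊆ (G⁻)` for some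
`b` (rational anticyclotomic anchor), then `I·𝒪⟦T₁,T₂⟧ ⊆ (G)` integrally. [folklore] -/
theorem map_le_span_of_rational_anchor {I : Ideal (IwasawaAlgebra₂ p)} (hI : I.IsPrincipal)
    (J : ℤ_[p] →+* PadicComplexInt p) {G : PowerSeries (PowerSeries (PadicComplexInt p))}
    (hμ : HasUnitContent (minus G))
    (hES : ∃ a : ℕ, PowerSeries.C (PowerSeries.C (((p : ℕ) : PadicComplexInt p) ^ a)) * G ∈
      I.map (toUnr₂ p J))
    (hAC : ∃ b : ℕ, ∀ x ∈ (I.map (toUnr₂ p J)).map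
        (PowerSeries.constantCoeff (R := PowerSeries (PadicComplexInt p))),
      PowerSeries.C (((p : ℕ) : PadicComplexInt p) ^ b) * x ∈ Ideal.span {minus G}) :
    I.map (toUnr₂ p J) ≤ Ideal.span {G} := by
  have hpS : ∀ k : ℕ, PowerSeries.C (PowerSeries.C (((p : ℕ) : PadicComplexInt p) ^ k)) =
      ((p : ℕ) : PowerSeries (PowerSeries (PadicComplexInt p))) ^ k := fun k ↦ by
    rw [map_pow, map_pow, map_natCast, map_natCast]
  have hp1 : ∀ k : ℕ, PowerSeries.C (((p : ℕ) : PadicComplexInt p) ^ k) =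
      ((p : ℕ) : PowerSeries (PadicComplexInt p)) ^ k := fun k ↦ by rw [map_pow, map_natCast]
  -- the generator `c₀` of `I` and its image `c`
  obtain ⟨⟨c₀, hc₀⟩⟩ := hI
  have hI' : I = Ideal.span {c₀} := hc₀
  have hIm : I.map (toUnr₂ p J) = Ideal.span {toUnr₂ p J c₀} := by
    rw [hI', Ideal.map_span, Set.image_singleton]
  rw [hIm, Ideal.span_singleton_le_span_singleton]
  obtain ⟨a, ha⟩ := hES
  obtain ⟨b, hb⟩ := hAC
  rw [hIm, hpS] at ha
  obtain ⟨h', hh'⟩ := Ideal.mem_span_singleton'.mp ha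
  -- `hh' : h' * c = p^a * G`
  have hG0 : minus G ≠ 0 := by
    rintro h0
    obtain ⟨n, hn⟩ := hμ
    rw [h0, map_zero] at hn
    exact not_isUnit_zero hn
  -- the case `c₀ = 0` is impossible
  by_cases hc00 : c₀ = 0
  · exfalso
    rw [hc00, map_zero, mul_zero] at hh'
    have hG : G = 0 := (mul_eq_zero.mp hh'.symm).resolve_left (pow_ne_zero _ natCast_ne_zero₂)
    exact hG0 (by rw [hG]; exact map_zero _)
  -- `μ`-decomposition `c₀ = p^μ c₁`, `p ∤ c₁`, in the UFD `Λ_K`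
  haveI : UniqueFactorizationMonoid (IwasawaAlgebra₂ p) :=
    Literature.NumberTheory.IwasawaTheory.uniqueFactorizationMonoid_powerSeries_powerSeries ℤ_[p]
  obtain ⟨μ, c₁, hc₁, hc₀μ⟩ :=
    WfDvdMonoid.max_power_factor' hc00 (not_isUnit_natCast_iwasawaAlgebra₂ (p := p))
  have hcJ : toUnr₂ p J c₀ = ((p : ℕ) : PowerSeries (PowerSeries (PadicComplexInt p))) ^ μ * toUnr₂ p J c₁ := by
    rw [hc₀μ, map_mul, map_pow, map_natCast]
  -- on the anticyclotomic line, `minus` of everything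
  have hminus_p : ∀ k : ℕ, minus (((p : ℕ) : PowerSeries (PowerSeries (PadicComplexInt p))) ^ k) =
      ((p : ℕ) : PowerSeries (PadicComplexInt p)) ^ k := fun k ↦ by
    unfold minus
    rw [map_pow, map_natCast]
  -- `μ ≤ a`: otherwise `p ∣ G⁻`
  have hμa : μ ≤ a := by
    by_contra hlt
    push Not at hlt
    obtain ⟨d, hd⟩ := Nat.exists_eq_add_of_lt hlt
    -- p^a G = h' p^μ c₁ = p^a · (p^(d+1) h' c₁)
    have h1 : G = ((p : ℕ) : PowerSeries (PowerSeries (PadicComplexInt p))) ^ (d + 1) * (h' * toUnr₂ p J c₁) := by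
      apply mul_left_cancel₀ (pow_ne_zero a natCast_ne_zero₂)
      rw [← hh', hcJ, hd]
      ring
    apply not_hasUnitContent_natCast_mul (p := p)
      (((p : ℕ) : PowerSeries (PadicComplexInt p)) ^ d * minus (h' * toUnr₂ p J c₁))
    have h2 : minus G = ((p : ℕ) : PowerSeries (PadicComplexInt p)) *
        (((p : ℕ) : PowerSeries (PadicComplexInt p)) ^ d * minus (h' * toUnr₂ p J c₁)) := by
      rw [h1, minus_mul, hminus_p]
      ring
    rwa [← h2]
  obtain ⟨e, he⟩ := Nat.exists_eq_add_of_le hμa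
  -- `c₁ ∣ p^e G`, hence (saturation) `c₁ ∣ G`: `G = c₁ g`
  have hdvd : toUnr₂ p J c₁ ∣ ((p : ℕ) : PowerSeries (PowerSeries (PadicComplexInt p))) ^ e * G := by
    refine ⟨h', mul_left_cancel₀ (pow_ne_zero μ natCast_ne_zero₂) ?_⟩
    calc ((p : ℕ) : PowerSeries (PowerSeries (PadicComplexInt p))) ^ μ * (((p : ℕ) : PowerSeries (PowerSeries (PadicComplexInt p))) ^ e * G) = ((p : ℕ) : PowerSeries (PowerSeries (PadicComplexInt p))) ^ a * G := by rw [he]; ring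
      _ = h' * toUnr₂ p J c₀ := hh'.symm
      _ = ((p : ℕ) : PowerSeries (PowerSeries (PadicComplexInt p))) ^ μ * (toUnr₂ p J c₁ * h') := by rw [hcJ]; ring
  obtain ⟨g, hg⟩ := dvd_of_toUnr₂_dvd_natCast_pow_mul hc₁ J e hdvd
  -- on the line: `G⁻ = c₁⁻ g⁻`, so `g⁻` has unit content
  have hgline : minus G = minus (toUnr₂ p J c₁) * minus g := by rw [hg, minus_mul]
  have hgμ : HasUnitContent (minus g) := hasUnitContent_right_of_mul (by rwa [← hgline])
  have hc₁0 : minus (toUnr₂ p J c₁) ≠ 0 := fun h0 ↦ hG0 (by rw [hgline, h0, zero_mul])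
  -- the rational anchor at `x = c⁻`: `p^b c⁻ = G⁻ m`, i.e. `p^(b+μ) c₁⁻ = c₁⁻ g⁻ m`
  have hcmem : minus (toUnr₂ p J c₀) ∈ (I.map (toUnr₂ p J)).map
      (PowerSeries.constantCoeff (R := PowerSeries (PadicComplexInt p))) := by
    rw [hIm]
    exact Ideal.mem_map_of_mem _ (Ideal.mem_span_singleton_self _)
  obtain ⟨m, hm⟩ := Ideal.mem_span_singleton'.mp (hb _ hcmem)
  -- `hm : m * minus G = C (p^b) * minus c₀`
  have hgdvd : minus g ∣ PowerSeries.C (((p : ℕ) : PadicComplexInt p) ^ (b + μ)) * 1 := by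
    refine ⟨m, mul_left_cancel₀ hc₁0 ?_⟩
    have h1 : PowerSeries.C (((p : ℕ) : PadicComplexInt p) ^ b) * minus (toUnr₂ p J c₀) =
        m * (minus (toUnr₂ p J c₁) * minus g) := by rw [← hgline]; exact hm.symm
    rw [hcJ, minus_mul, hminus_p, hp1] at h1
    rw [mul_one, hp1, pow_add]
    linear_combination h1
  -- cancellation against unit content (the tree's Weierstrass-division theorem, applied to `C g⁻`)
  have hgunit : IsUnit (minus g) := by
    have h2 : (PowerSeries.C (minus g) : PowerSeries (PowerSeries (PadicComplexInt p))) ∣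
        PowerSeries.map (PowerSeries.C (R := PadicComplexInt p))
          (PowerSeries.C (((p : ℕ) : PadicComplexInt p) ^ (b + μ))) * 1 := by
      rw [PowerSeries.map_C, mul_one]
      obtain ⟨m', hm'⟩ := hgdvd
      exact ⟨PowerSeries.C m', by rw [← map_mul, ← hm', mul_one]⟩
    have hμ' : HasUnitContent (minus (PowerSeries.C (minus g) : PowerSeries (PowerSeries (PadicComplexInt p)))) := by
      rwa [show minus (PowerSeries.C (minus g) : PowerSeries (PowerSeries (PadicComplexInt p))) = minus g from PowerSeries.constantCoeff_C _]
    have h3 := dvd_of_dvd_map_C_mul_of_hasUnitContent_minus hμ'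
      (by rw [hp1]; exact pow_ne_zero _ (by
        rw [show ((p : ℕ) : PowerSeries (PadicComplexInt p)) = PowerSeries.C ((p : ℕ) : PadicComplexInt p) by
          rw [map_natCast]]
        intro h0
        exact natCast_prime_padicComplexInt_ne_zero (p := p) (by simpa using congrArg PowerSeries.constantCoeff h0)))
      h2
    have h4 := map_dvd (PowerSeries.constantCoeff (R := PowerSeries (PadicComplexInt p))) h3
    rw [PowerSeries.constantCoeff_C, map_one] at h4
    exact isUnit_of_dvd_one h4
  have hgU : IsUnit g := PowerSeries.isUnit_iff_constantCoeff.mpr hgunit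
  -- conclusion: `c = p^μ c₁ = p^μ g⁻¹ G ∈ (G)`
  rw [hcJ]
  obtain ⟨u, hu⟩ := hgU
  refine ⟨((p : ℕ) : PowerSeries (PowerSeries (PadicComplexInt p))) ^ μ * ↑u⁻¹, ?_⟩
  rw [hg, ← hu]
  calc ((p : ℕ) : PowerSeries (PowerSeries (PadicComplexInt p))) ^ μ * toUnr₂ p J c₁
      = ((p : ℕ) : PowerSeries (PowerSeries (PadicComplexInt p))) ^ μ * toUnr₂ p J c₁ * ((u : _) * ↑u⁻¹) := by
        rw [Units.mul_inv, mul_one]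
    _ = toUnr₂ p J c₁ * ↑u * (((p : ℕ) : PowerSeries (PowerSeries (PadicComplexInt p))) ^ μ * ↑u⁻¹) := by
        ring

/-! ## §3 The registered stubs imply their rational forms -/

/-- ES ⇒ ES-rat with `a = 0`. [folklore] -/
theorem esRat_of_es {I : Ideal (PowerSeries (PowerSeries (PadicComplexInt p)))}
    {G : PowerSeries (PowerSeries (PadicComplexInt p))} (h : Ideal.span {G} ≤ I) :
    ∃ a : ℕ, PowerSeries.C (PowerSeries.C (((p : ℕ) : PadicComplexInt p) ^ a)) * G ∈ I :=
  ⟨0, by simpa using h (Ideal.mem_span_singleton_self G)⟩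

/-- ACdiv ⇒ ACdiv-rat with `b = 0`. [folklore] -/
theorem acDivRat_of_acDiv {𝔞 : Ideal (PowerSeries (PadicComplexInt p))} {Gm : PowerSeries (PadicComplexInt p)}
    (h : 𝔞 ≤ Ideal.span {Gm}) :
    ∃ b : ℕ, ∀ x ∈ 𝔞, PowerSeries.C (((p : ℕ) : PadicComplexInt p) ^ b) * x ∈ Ideal.span {Gm} :=
  ⟨0, fun x hx ↦ by simpa using h hx⟩

end Summit.BirchSwinnertonDyer.BirchSwinnertonDyer.Theorems.SignedBaseChangeK1RationalAnchor

end
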